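import Mathlib
import Summits.Ventures.PercRepro2.A3CutOBehind

/-!
# (FM) = (MEANS-a₃) + a BHK bracket: `FMfun(x) = btw(x) + (γ₀ − γ) · BR(x)` with `BR(x) ≥ 0`
(blind cell PercRepro2, night-1 g33; proofs/NIGHT1-G33.md §10; census mining/night-1/g33/check_fm_btw_general.py
128/128 general instances, check_gamma0_ge_gamma.py 380/380)

The first-order functional differs from the means-level form only through the centring `γ₀ = P(Q, o ∈ U)/P(Q)`
in place of `γ = D_o/D`: since `F⁰_o(γ₀) = F⁰_o(γ) + σ₃ (γ₀ − γ) m_W` on every fibre (`SFg_shift`) and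
`∑_A Suo = γ D`, **`FMfun(x) = btw(x) + (γ₀ − γ) · BR`** (`FMfun_eq_btw_add`, `D ≠ 0`) with
`BR = E_Q[σ₃ σ_b] − E_Q[σ_b] E_Q[σ₃] + P(PD, b ∈ U) − D · P(Q, b ∈ U)/P(Q)` (in the cell's vocabulary
`EQb3 − EQo_b · EQ3 / P(Q) + Do_b − D · mU_b / P(Q)`), and `BR` is twice the BHK bracket of A3CutOBehind,
`2 [(P(T′) P(Q, b ∈ C₂) + P(T) P(Q, b ∈ C₁)) / P(Q) − P(T′, b ∈ C₂) − P(T, b ∈ C₁)] ≥ 0`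
(`BR_eq`, `BR_nonneg`, BHK06 Thm 1.4 on `Q` twice via `CutOBehind.bhk_Tp`, `bhk_T`).  Hence
**`FM_of_A3Between_of_gamma_le`**: (MEANS-a₃) at `x` together with `γ ≤ γ₀` — the positive association
of `U_o` and `U_x` on `Q`, `D_o · P(Q) ≤ P(Q, o ∈ U) · D` (`gamma_le_gamma0_iff`; census 380/380 on random
graphs, a BHK-flavoured two-point inequality) — gives (FM) at `x`.  The reduction (MEANS-a₃) ∧ (FM) of the
exploration-martingale route is thereby (MEANS-a₃) ∧ (γ ≤ γ₀).  Standard axioms.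
-/

namespace Summit.Ventures.PercRepro2

open UnionCluster CovForm

namespace CovForm

namespace A3Fibre

namespace FMDecomp

section Shift

variable {V : Type*} {E : Type*} [Fintype V] [DecidableEq V] [Fintype E] [DecidableEq E]
  {R : Type*} [Field R] [LinearOrder R] [IsStrictOrderedRing R] {ends : E → Sym2 V} {p : E → R}
  {o a₁ a₂ x b : V}

omit [Fintype V] [LinearOrder R] [IsStrictOrderedRing R] in
/-- `F⁰_o(γ') = F⁰_o(γ) + σ₃ (γ' − γ) m_W`. -/
lemma SFg_shift (γ γ' : R) (W : Finset V) :
    RootEdge.SFg p ends o a₁ a₂ x γ' W =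
      RootEdge.SFg p ends o a₁ a₂ x γ W + s3 a₁ a₂ W * ((γ' - γ) * mW p ends a₁ a₂ x W) := by
  unfold RootEdge.SFg
  ring

omit [Fintype V] in
/-- `Sb F⁰_o(γ') / m_W = Sb F⁰_o(γ) / m_W + σ₃ (γ' − γ) Sb`. -/
lemma term_shift (hp : IsProbVec p) (γ γ' : R) (W : Finset V) :
    Ssig p ends a₁ a₂ x b W * RootEdge.SFg p ends o a₁ a₂ x γ' W / mW p ends a₁ a₂ x W =
      Ssig p ends a₁ a₂ x b W * RootEdge.SFg p ends o a₁ a₂ x γ W / mW p ends a₁ a₂ x W +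
        s3 a₁ a₂ W * ((γ' - γ) * Ssig p ends a₁ a₂ x b W) := by
  by_cases hm : mW p ends a₁ a₂ x W = 0
  · have hf : prob p (fibre ends a₁ a₂ x W) = 0 := hm
    have hS : Ssig p ends a₁ a₂ x b W = 0 := by
      unfold Ssig
      rw [prob_fibre_inter_eq_zero hp ends a₁ a₂ x hf, prob_fibre_inter_eq_zero hp ends a₁ a₂ x hf,
        sub_zero]
    simp only [hm, hS, zero_mul, zero_div, mul_zero, add_zero]
  · rw [SFg_shift γ γ' W]
    field_simp

/-- `∑_W Sb F⁰_o(γ') / m_W = ∑_W Sb F⁰_o(γ) / m_W + (γ' − γ) ∑_W σ₃ Sb`. -/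
lemma sum_term_shift (hp : IsProbVec p) (γ γ' : R) :
    ∑ W : Finset V, Ssig p ends a₁ a₂ x b W * RootEdge.SFg p ends o a₁ a₂ x γ' W /
        mW p ends a₁ a₂ x W =
      ∑ W : Finset V, Ssig p ends a₁ a₂ x b W * RootEdge.SFg p ends o a₁ a₂ x γ W /
          mW p ends a₁ a₂ x W +
        (γ' - γ) * ∑ W : Finset V, s3 a₁ a₂ W * Ssig p ends a₁ a₂ x b W := by
  rw [Finset.mul_sum, ← Finset.sum_add_distrib]
  refine Finset.sum_congr rfl fun W _ => ?_
  rw [term_shift hp γ γ' W]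
  ring

omit [LinearOrder R] [IsStrictOrderedRing R] in
/-- `∑_W F⁰_o(γ') = ∑_W F⁰_o(γ) + (γ' − γ) ∑_W σ₃ m_W`. -/
lemma sum_SFg_shift (γ γ' : R) :
    ∑ W : Finset V, RootEdge.SFg p ends o a₁ a₂ x γ' W =
      ∑ W : Finset V, RootEdge.SFg p ends o a₁ a₂ x γ W +
        (γ' - γ) * ∑ W : Finset V, s3 a₁ a₂ W * mW p ends a₁ a₂ x W := by
  rw [Finset.mul_sum, ← Finset.sum_add_distrib]
  refine Finset.sum_congr rfl fun W _ => ?_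
  rw [SFg_shift γ γ' W]
  ring

omit [Fintype V] [DecidableEq V] in
/-- `P(Q) ≠ 0` when `D ≠ 0`. -/
lemma prob_Q_ne_zero (hp : IsProbVec p) (hD : prob p (PDEvent ends a₁ a₂ x) ≠ 0) :
    prob p (avoidAll ends a₂ {a₁}) ≠ 0 := by
  intro h0
  apply hD
  have key : prob p (PDEvent ends a₁ a₂ x) ≤ prob p (avoidAll ends a₂ {a₁}) := by
    refine prob_mono hp fun ω hω => ?_
    rw [mem_avoidAll]
    intro t ht
    rw [Finset.mem_singleton] at ht
    rw [ht]
    exact fun hc => hω.1 (conn_symm hc)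
  rw [h0] at key
  exact le_antisymm key (prob_nonneg hp _)

/-- **(FM) = (MEANS-a₃) + (γ₀ − γ) · BR**: the first-order functional is the means-level form plus the
centring gap times the `b`-bracket `BR = EQb3 − EQo_b EQ3 / P(Q) + Do_b − D mU_b / P(Q)`. -/
theorem FMfun_eq_btw_add (hp : IsProbVec p) (hD : prob p (PDEvent ends a₁ a₂ x) ≠ 0) :
    FMfun p ends o a₁ a₂ x b = btw p ends o a₁ a₂ x b +
      (gamma0 p ends o a₁ a₂ - gamma p ends o a₁ a₂ x) *
        (EQb3 p ends a₁ a₂ x b -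
          EQo p ends b a₁ a₂ * EQ3 p ends a₁ a₂ x / prob p (avoidAll ends a₂ {a₁}) +
          Do p ends b a₁ a₂ x -
          prob p (PDEvent ends a₁ a₂ x) * LeafStep.mU p ends a₁ a₂ b /
            prob p (avoidAll ends a₂ {a₁})) := by
  have hQ := prob_Q_ne_zero hp hD
  have hDo : Do p ends o a₁ a₂ x = gamma p ends o a₁ a₂ x * prob p (PDEvent ends a₁ a₂ x) := by
    unfold gamma
    rw [div_mul_cancel₀ _ hD]
  unfold FMfun
  rw [← RootEdge.btwg_gamma]
  unfold RootEdge.btwg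
  rw [sum_term_shift hp (gamma p ends o a₁ a₂ x) (gamma0 p ends o a₁ a₂),
    sum_SFg_shift (gamma p ends o a₁ a₂ x) (gamma0 p ends o a₁ a₂), ← EQb3_eq, ← EQ3_eq,
    ← EQo_eq p ends b a₁ a₂ x, ← Do_eq_fibresA p ends b a₁ a₂ x, ← Do_eq_fibresA p ends o a₁ a₂ x, hDo]
  unfold gamma0
  field_simp
  ring

end Shift

section Bracket

variable {V : Type*} {E : Type*} [Fintype V] [DecidableEq V] [Fintype E] [DecidableEq E]
  {R : Type*} [Field R] [LinearOrder R] [IsStrictOrderedRing R] {ends : E → Sym2 V} {p : E → R}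
  {o a₁ a₂ x b : V}

omit [Fintype V] [LinearOrder R] [IsStrictOrderedRing R] in
/-- The `b`-bracket is twice the BHK bracket:
`BR = 2 [(P(T′) P(Q, b ∈ C₂) + P(T) P(Q, b ∈ C₁)) / P(Q) − P(T′, b ∈ C₂) − P(T, b ∈ C₁)]`. -/
lemma BR_eq (hQ : prob p (avoidAll ends a₂ {a₁}) ≠ 0) :
    EQb3 p ends a₁ a₂ x b - EQo p ends b a₁ a₂ * EQ3 p ends a₁ a₂ x / prob p (avoidAll ends a₂ {a₁}) +
        Do p ends b a₁ a₂ x -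
        prob p (PDEvent ends a₁ a₂ x) * LeafStep.mU p ends a₁ a₂ b / prob p (avoidAll ends a₂ {a₁}) =
      2 * ((prob p (TEvent ends a₂ a₁ x) * prob p (avoidAll ends a₂ {a₁} ∩ connEvent ends a₂ b) +
            prob p (TEvent ends a₁ a₂ x) * prob p (avoidAll ends a₂ {a₁} ∩ connEvent ends a₁ b)) /
          prob p (avoidAll ends a₂ {a₁}) -
          (prob p (TEvent ends a₂ a₁ x ∩ connEvent ends a₂ b) +
            prob p (TEvent ends a₁ a₂ x ∩ connEvent ends a₁ b))) := by
  have hD : prob p (PDEvent ends a₁ a₂ x) =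
      prob p (avoidAll ends a₂ {a₁}) - prob p (TEvent ends a₁ a₂ x) -
        prob p (TEvent ends a₂ a₁ x) := by
    have key := Qsplit_univ p ends a₁ a₂ x
    linear_combination -key
  have hb1 : prob p (PDEvent ends a₁ a₂ x ∩ connEvent ends a₁ b) =
      prob p (avoidAll ends a₂ {a₁} ∩ connEvent ends a₁ b) -
        prob p (TEvent ends a₁ a₂ x ∩ connEvent ends a₁ b) -
        prob p (TEvent ends a₂ a₁ x ∩ connEvent ends a₁ b) := by
    have key := Qsplit p ends a₁ a₂ x (connEvent ends a₁ b)
    linear_combination -key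
  have hb2 : prob p (PDEvent ends a₁ a₂ x ∩ connEvent ends a₂ b) =
      prob p (avoidAll ends a₂ {a₁} ∩ connEvent ends a₂ b) -
        prob p (TEvent ends a₁ a₂ x ∩ connEvent ends a₂ b) -
        prob p (TEvent ends a₂ a₁ x ∩ connEvent ends a₂ b) := by
    have key := Qsplit p ends a₁ a₂ x (connEvent ends a₂ b)
    linear_combination -key
  unfold EQb3 EQo EQ3 Do LeafStep.mU
  rw [hD, hb1, hb2]
  field_simp
  ring

/-- **The `b`-bracket is nonnegative** (BHK06 Thm 1.4 on `Q` twice). -/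
lemma BR_nonneg (hp : IsProbVec p) (hQ : prob p (avoidAll ends a₂ {a₁}) ≠ 0) :
    0 ≤ EQb3 p ends a₁ a₂ x b -
        EQo p ends b a₁ a₂ * EQ3 p ends a₁ a₂ x / prob p (avoidAll ends a₂ {a₁}) +
        Do p ends b a₁ a₂ x -
        prob p (PDEvent ends a₁ a₂ x) * LeafStep.mU p ends a₁ a₂ b / prob p (avoidAll ends a₂ {a₁}) := by
  rw [BR_eq hQ]
  refine mul_nonneg (by norm_num) ?_
  rw [sub_nonneg]
  have hQ' : 0 < prob p (avoidAll ends a₂ {a₁}) :=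
    lt_of_le_of_ne (prob_nonneg hp _) (Ne.symm hQ)
  rw [le_div_iff₀ hQ', add_mul]
  exact add_le_add (CutOBehind.bhk_Tp hp ends a₁ a₂ x b) (CutOBehind.bhk_T hp ends a₁ a₂ x b)

omit [Fintype V] [DecidableEq V] in
/-- `γ ≤ γ₀` is the positive association `D_o · P(Q) ≤ P(Q, o ∈ U) · D` of `U_o` and `U_x` on `Q`. -/
lemma gamma_le_gamma0_iff (hp : IsProbVec p) (hD : prob p (PDEvent ends a₁ a₂ x) ≠ 0) :
    gamma p ends o a₁ a₂ x ≤ gamma0 p ends o a₁ a₂ ↔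
      Do p ends o a₁ a₂ x * prob p (avoidAll ends a₂ {a₁}) ≤
        LeafStep.mU p ends a₁ a₂ o * prob p (PDEvent ends a₁ a₂ x) := by
  have hQ' : 0 < prob p (avoidAll ends a₂ {a₁}) :=
    lt_of_le_of_ne (prob_nonneg hp _) (Ne.symm (prob_Q_ne_zero hp hD))
  have hD' : 0 < prob p (PDEvent ends a₁ a₂ x) := lt_of_le_of_ne (prob_nonneg hp _) (Ne.symm hD)
  unfold gamma gamma0
  rw [div_le_div_iff₀ hD' hQ']

/-- **(FM) from (MEANS-a₃) and the centring inequality `γ ≤ γ₀`.** -/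
theorem FM_of_A3Between_of_gamma_le (hp : IsProbVec p) (hD : prob p (PDEvent ends a₁ a₂ x) ≠ 0)
    (hA : A3Between p ends o a₁ a₂ x b) (hγ : gamma p ends o a₁ a₂ x ≤ gamma0 p ends o a₁ a₂) :
    FM p ends o a₁ a₂ x b := by
  unfold FM
  rw [FMfun_eq_btw_add hp hD]
  exact add_nonneg hA (mul_nonneg (sub_nonneg.2 hγ) (BR_nonneg hp (prob_Q_ne_zero hp hD)))

/-- **(FM) from (MEANS-a₃) and the positive association of `U_o`, `U_x` on `Q`.** -/
theorem FM_of_A3Between_of_UU (hp : IsProbVec p) (hD : prob p (PDEvent ends a₁ a₂ x) ≠ 0)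
    (hA : A3Between p ends o a₁ a₂ x b)
    (hUU : Do p ends o a₁ a₂ x * prob p (avoidAll ends a₂ {a₁}) ≤
      LeafStep.mU p ends a₁ a₂ o * prob p (PDEvent ends a₁ a₂ x)) : FM p ends o a₁ a₂ x b :=
  FM_of_A3Between_of_gamma_le hp hD hA ((gamma_le_gamma0_iff hp hD).2 hUU)

end Bracket

end FMDecomp

end A3Fibre

end CovForm

end Summit.Ventures.PercRepro2
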